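import Summits.BirchSwinnertonDyer.BirchSwinnertonDyer.Theorems.ManinLocalTwoThreeManinOfStevensPrimeLevels
import Summits.BirchSwinnertonDyer.BirchSwinnertonDyer.Theorems.ManinLocalTwoThreeShimuraQuotientLevelInstances
import HarnessLib

/-!
# Manin's `|c₀| = |c₁|` and `|c₀| = 1` at the REDUCED levels: unconditional Γ₀/Γ₁ transfer at `N = 9M` (`3 ∤ φ(3M)`) and
# `N = 4q^e` (`q ≡ 3 mod 4`); index-`4`-free Stevens road at `N = 8p, 16p, 32, 64, 128, 256`
Summit `BirchSwinnertonDyer`, route `ManinLocalTwoThree` (cell bsd-f2-manin), cruxes C2 `ManinOddAtFour` (stmt-BirchSwinnertonDyer-22967) and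
C3 `ManinPrimeToThreeAtNine` (stmt-BirchSwinnertonDyer-22968); lead p1 gen 15.  By-name corollaries of the cuspidal-inertia level
reduction (`…ShimuraQuotientCuspidalInertia`, `…ShimuraQuotientLevelInstances`: the Shimura quotient `Λ₀(f)/Λ₁(f)` is a quotient of
`(ℤ/uv)ˣ/{±1}` for every `N = u²v`) fed into the Stevens road (`…ManinOfStevensConjectures`, `…ManinOfStevensPrimeLevels`).
* §1 **UNCONDITIONAL TRANSFER** `|c₀| = |c₁|` for the optimal `X₁(N)`/`X₀(N)` pair of a class (no Stevens II, no cell law):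
  `natAbs_maninConstant₀_eq_of_nine_mul_of_coprime_totient` (`N = 9M`, `3 ∤ φ(3M)`), `…_of_nine_mul_prime` (`N = 9p`, `p ≡ 2 (mod 3)`),
  `natAbs_maninConstant₀_eq_of_four_mul_prime_pow` (`N = 4q^e`, `q ≡ 3 (mod 4)`), `…_of_four_mul_prime'` (`N = 4p`, `p ≡ 3 (mod 4)`) —
  at these levels `Λ₁(f) = Λ₀(f)`, Stevens' curve IS the optimal curve; hence **Stevens I alone ⟹ `|c₀| = 1`**:
  `natAbs_maninConstant₀_eq_one_of_stevensConstantOne_nine_mul` / `…_four_mul_prime_pow` (+ `_of_exists` F-need forms,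
  `not_three_dvd_…` / `not_two_dvd_…`).  (The tree's `N = 9p` theorems `…_of_stevensConjectures_nine_mul_prime` needed Stevens II.)
* §2 **INDEX-`4`-FREE STEVENS ROAD at `N = 8p, 16p` (`p` odd prime) and `N = 32, 64, 128, 256`**: Stevens II ⟹ `|c₀| = |c₁|`
  (`natAbs_maninConstant₀_eq_of_maxCovolume_of_generator_mod`, `…_eight_mul_prime`, `…_sixteen_mul_prime`, `…_two_power`), Stevens I ∧ II ⟹
  `|c₀| = 1` and `2 ∤ c₀` (the tree had this at `N = 4p` only).
HONEST FRAMING: §1 is unconditional as a TRANSFER but Manin's `|c₀| = 1` there still needs Stevens I (`c₁ = ±1`, OPEN; tree predicate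
`ManinConstant.StevensConstantOne`, nothing asserted) and F-need (statement-only); §2 needs Stevens I ∧ II.  BSD is not proved; Manin's
conjecture is not proved; C2/C3 OPEN.  No definitions, no named facts, no sorry.
[cite: Stevens1989, §2, Conjectures I–II, Thm. 2.3] [cite: LingOesterle1991, Thm. 1 and Thm. 6]
-/

set_option autoImplicit false
-- the summit-side namespace `Summit.BirchSwinnertonDyer.BirchSwinnertonDyer.…` is the tree's (summit = sub-problem)
set_option linter.dupNamespace false

noncomputable section

open scoped Classical

open WeierstrassCurve Literature.NumberTheory.EllipticCurves Literature.NumberTheory.EllipticCurves.ModularForms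
open CongruenceSubgroup
open Summit.BirchSwinnertonDyer.Rank1Residual.ManinAdditive.ShimuraKernel
open Summit.BirchSwinnertonDyer.Rank1Residual.ManinAdditive.KatoCurve
open Summit.BirchSwinnertonDyer.Rank1Residual.ManinConstant

namespace Summit.BirchSwinnertonDyer.BirchSwinnertonDyer.Theorems.ManinLocalTwoThree

variable {W₁ W₀ : WeierstrassCurve ℚ} [W₁.IsElliptic] [W₁.IsGloballyMinimal] [W₀.IsElliptic]
  [W₀.IsGloballyMinimal]

/-! ## §1 Unconditional transfer at the collapse levels; Manin from Stevens I alone -/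

/-- **`N = 9M`, `3 ∤ φ(3M)`: `|c₀| = |c₁|` UNCONDITIONALLY** for an optimal `X₁(N)`-datum `D₁` and a lattice-optimal `X₀(N)`-datum `D₀` of
isogenous globally minimal curves (`Λ₁(f) = Λ₀(f)` by `periodLatticeGamma1_eq_of_nine_mul_of_coprime_totient`, then the tree's
`natAbs_maninConstant₀_eq_of_periodLatticeGamma1_eq_periodLattice`). [cite: Stevens1989, §2] [cite: LingOesterle1991, Thm. 1 and Thm. 6] -/
theorem natAbs_maninConstant₀_eq_of_nine_mul_of_coprime_totient {N M : ℕ} [NeZero N] (hN : N = 9 * M)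
    (hcop : Nat.Coprime 3 (Nat.totient (3 * M)))
    (D₁ : Gamma1ParametrizationData W₁ N) (D₀ : ModularParametrizationData W₀ N) (hiso : IsIsogenous W₁ W₀)
    (h₁ : D₁.IsOptimal) (h₀ : ∀ z ∈ D₀.L.lattice, ∃ w ∈ periodLattice D₀.f, z = D₀.c * w) :
    D₀.maninConstant.natAbs = D₁.maninConstant.natAbs :=
  natAbs_maninConstant₀_eq_of_periodLatticeGamma1_eq_periodLattice D₁ D₀ h₁ h₀ (D₁.f_eq_of_isIsogenous D₀ hiso)
    (periodLatticeGamma1_eq_of_nine_mul_of_coprime_totient hN hcop D₀)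

/-- **`N = 9p`, `p ≡ 2 (mod 3)` prime: `|c₀| = |c₁|` UNCONDITIONALLY.** [cite: Stevens1989, §2] [cite: LingOesterle1991, Thm. 6] -/
theorem natAbs_maninConstant₀_eq_of_nine_mul_prime {p : ℕ} (hp : p.Prime) (hp3 : p % 3 = 2) [NeZero (9 * p)]
    (D₁ : Gamma1ParametrizationData W₁ (9 * p)) (D₀ : ModularParametrizationData W₀ (9 * p))
    (hiso : IsIsogenous W₁ W₀) (h₁ : D₁.IsOptimal)
    (h₀ : ∀ z ∈ D₀.L.lattice, ∃ w ∈ periodLattice D₀.f, z = D₀.c * w) :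
    D₀.maninConstant.natAbs = D₁.maninConstant.natAbs :=
  natAbs_maninConstant₀_eq_of_periodLatticeGamma1_eq_periodLattice D₁ D₀ h₁ h₀ (D₁.f_eq_of_isIsogenous D₀ hiso)
    (periodLatticeGamma1_eq_of_nine_mul_prime hp hp3 D₀)

/-- **`N = 4q^e`, `q ≡ 3 (mod 4)` prime: `|c₀| = |c₁|` UNCONDITIONALLY** — E-an-151 `GammaOneTransferAtFour` HOLDS at these levels with no
law (`Λ₁(f) = Λ₀(f)` by `periodLatticeGamma1_eq_of_four_mul_prime_pow`). [cite: Stevens1989, §2] [cite: LingOesterle1991, Thm. 1 and Thm. 6] -/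
theorem natAbs_maninConstant₀_eq_of_four_mul_prime_pow {N q e : ℕ} [NeZero N] (hq : q.Prime) (hq3 : q % 4 = 3)
    (he : e ≠ 0) (hN : N = 4 * q ^ e)
    (D₁ : Gamma1ParametrizationData W₁ N) (D₀ : ModularParametrizationData W₀ N) (hiso : IsIsogenous W₁ W₀)
    (h₁ : D₁.IsOptimal) (h₀ : ∀ z ∈ D₀.L.lattice, ∃ w ∈ periodLattice D₀.f, z = D₀.c * w) :
    D₀.maninConstant.natAbs = D₁.maninConstant.natAbs :=
  natAbs_maninConstant₀_eq_of_periodLatticeGamma1_eq_periodLattice D₁ D₀ h₁ h₀ (D₁.f_eq_of_isIsogenous D₀ hiso)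
    (periodLatticeGamma1_eq_of_four_mul_prime_pow hq hq3 he hN D₀)

/-- **`N = 4p`, `p ≡ 3 (mod 4)` prime: `|c₀| = |c₁|` UNCONDITIONALLY.** [cite: Stevens1989, §2] [cite: LingOesterle1991, Thm. 6] -/
theorem natAbs_maninConstant₀_eq_of_four_mul_prime' {p : ℕ} (hp : p.Prime) (hp3 : p % 4 = 3) [NeZero (4 * p)]
    (D₁ : Gamma1ParametrizationData W₁ (4 * p)) (D₀ : ModularParametrizationData W₀ (4 * p))
    (hiso : IsIsogenous W₁ W₀) (h₁ : D₁.IsOptimal)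
    (h₀ : ∀ z ∈ D₀.L.lattice, ∃ w ∈ periodLattice D₀.f, z = D₀.c * w) :
    D₀.maninConstant.natAbs = D₁.maninConstant.natAbs :=
  natAbs_maninConstant₀_eq_of_periodLatticeGamma1_eq_periodLattice D₁ D₀ h₁ h₀ (D₁.f_eq_of_isIsogenous D₀ hiso)
    (periodLatticeGamma1_eq_of_four_mul_prime hp hp3 D₀)

/-- **`N = 9M`, `3 ∤ φ(3M)`: Stevens I ALONE ⟹ `|c₀| = 1`** for every lattice-optimal `X₀(N)`-datum isogenous to an optimal `X₁(N)`-datum.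
CONDITIONAL on Stevens I (OPEN). [cite: Stevens1989, Conjecture I] -/
theorem natAbs_maninConstant₀_eq_one_of_stevensConstantOne_nine_mul {N M : ℕ} [NeZero N] (hN : N = 9 * M)
    (hcop : Nat.Coprime 3 (Nat.totient (3 * M)))
    (D₁ : Gamma1ParametrizationData W₁ N) (D₀ : ModularParametrizationData W₀ N) (hiso : IsIsogenous W₁ W₀)
    (h₁ : D₁.IsOptimal) (h₀ : ∀ z ∈ D₀.L.lattice, ∃ w ∈ periodLattice D₀.f, z = D₀.c * w) (hSt1 : StevensConstantOne) :
    D₀.maninConstant.natAbs = 1 := by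
  rw [natAbs_maninConstant₀_eq_of_nine_mul_of_coprime_totient hN hcop D₁ D₀ hiso h₁ h₀]
  exact natAbs_maninConstant_eq_one_of_stevensConstantOne hSt1 D₁ h₁

/-- **C3 at `N = 9M`, `3 ∤ φ(3M)`, from Stevens I alone: `3 ∤ c₀`.** CONDITIONAL on Stevens I; C3 OPEN. [cite: Stevens1989, Conjecture I] -/
theorem not_three_dvd_maninConstant₀_of_stevensConstantOne_nine_mul {N M : ℕ} [NeZero N] (hN : N = 9 * M)
    (hcop : Nat.Coprime 3 (Nat.totient (3 * M)))
    (D₁ : Gamma1ParametrizationData W₁ N) (D₀ : ModularParametrizationData W₀ N) (hiso : IsIsogenous W₁ W₀)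
    (h₁ : D₁.IsOptimal) (h₀ : ∀ z ∈ D₀.L.lattice, ∃ w ∈ periodLattice D₀.f, z = D₀.c * w) (hSt1 : StevensConstantOne) :
    ¬ (3 : ℤ) ∣ D₀.maninConstant := by
  intro h3
  have h3' : (3 : ℤ).natAbs ∣ D₀.maninConstant.natAbs := Int.natAbs_dvd_natAbs.mpr h3
  rw [natAbs_maninConstant₀_eq_one_of_stevensConstantOne_nine_mul hN hcop D₁ D₀ hiso h₁ h₀ hSt1] at h3'
  norm_num at h3'

omit [W₁.IsElliptic] [W₁.IsGloballyMinimal] in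
/-- **`N = 9M`, `3 ∤ φ(3M)`, F-need form: F-need ∧ Stevens I ⟹ `3 ∤ c₀` (indeed `|c₀| = 1`) for EVERY lattice-optimal `X₀(N)`-datum** —
C3 at these levels with NO Stevens II and NO cell law.  CONDITIONAL; C3 OPEN; BSD not proved. [cite: Stevens1989, Conjecture I] -/
theorem not_three_dvd_maninConstant₀_of_stevensConstantOne_nine_mul_of_exists {N M : ℕ} [NeZero N] (hN : N = 9 * M)
    (hcop : Nat.Coprime 3 (Nat.totient (3 * M))) (hex : exists_optimal_gamma1ParametrizationData)
    (hSt1 : StevensConstantOne) (D₀ : ModularParametrizationData W₀ N)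
    (h₀ : ∀ z ∈ D₀.L.lattice, ∃ w ∈ periodLattice D₀.f, z = D₀.c * w) : ¬ (3 : ℤ) ∣ D₀.maninConstant := by
  obtain ⟨W₁, _, _, D₁, hiso, h₁⟩ := hex W₀ D₀ h₀
  exact not_three_dvd_maninConstant₀_of_stevensConstantOne_nine_mul hN hcop D₁ D₀ hiso h₁ h₀ hSt1

/-- **`N = 9p`, `p ≡ 2 (mod 3)`: Stevens I ALONE ⟹ `|c₀| = 1`** (sharpens `…_of_stevensConjectures_nine_mul_prime`: no Stevens II).
CONDITIONAL on Stevens I. [cite: Stevens1989, Conjecture I] -/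
theorem natAbs_maninConstant₀_eq_one_of_stevensConstantOne_nine_mul_prime {p : ℕ} (hp : p.Prime) (hp3 : p % 3 = 2)
    [NeZero (9 * p)] (D₁ : Gamma1ParametrizationData W₁ (9 * p)) (D₀ : ModularParametrizationData W₀ (9 * p))
    (hiso : IsIsogenous W₁ W₀) (h₁ : D₁.IsOptimal)
    (h₀ : ∀ z ∈ D₀.L.lattice, ∃ w ∈ periodLattice D₀.f, z = D₀.c * w) (hSt1 : StevensConstantOne) :
    D₀.maninConstant.natAbs = 1 := by
  rw [natAbs_maninConstant₀_eq_of_nine_mul_prime hp hp3 D₁ D₀ hiso h₁ h₀]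
  exact natAbs_maninConstant_eq_one_of_stevensConstantOne hSt1 D₁ h₁

/-- **`N = 4q^e`, `q ≡ 3 (mod 4)`: Stevens I ALONE ⟹ `|c₀| = 1`.** CONDITIONAL on Stevens I. [cite: Stevens1989, Conjecture I] -/
theorem natAbs_maninConstant₀_eq_one_of_stevensConstantOne_four_mul_prime_pow {N q e : ℕ} [NeZero N] (hq : q.Prime)
    (hq3 : q % 4 = 3) (he : e ≠ 0) (hN : N = 4 * q ^ e)
    (D₁ : Gamma1ParametrizationData W₁ N) (D₀ : ModularParametrizationData W₀ N) (hiso : IsIsogenous W₁ W₀)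
    (h₁ : D₁.IsOptimal) (h₀ : ∀ z ∈ D₀.L.lattice, ∃ w ∈ periodLattice D₀.f, z = D₀.c * w) (hSt1 : StevensConstantOne) :
    D₀.maninConstant.natAbs = 1 := by
  rw [natAbs_maninConstant₀_eq_of_four_mul_prime_pow hq hq3 he hN D₁ D₀ hiso h₁ h₀]
  exact natAbs_maninConstant_eq_one_of_stevensConstantOne hSt1 D₁ h₁

/-- **C2 at `N = 4q^e`, `q ≡ 3 (mod 4)`, from Stevens I alone: `2 ∤ c₀`.** CONDITIONAL on Stevens I; C2 OPEN. [cite: Stevens1989, Conjecture I] -/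
theorem not_two_dvd_maninConstant₀_of_stevensConstantOne_four_mul_prime_pow {N q e : ℕ} [NeZero N] (hq : q.Prime)
    (hq3 : q % 4 = 3) (he : e ≠ 0) (hN : N = 4 * q ^ e)
    (D₁ : Gamma1ParametrizationData W₁ N) (D₀ : ModularParametrizationData W₀ N) (hiso : IsIsogenous W₁ W₀)
    (h₁ : D₁.IsOptimal) (h₀ : ∀ z ∈ D₀.L.lattice, ∃ w ∈ periodLattice D₀.f, z = D₀.c * w) (hSt1 : StevensConstantOne) :
    ¬ (2 : ℤ) ∣ D₀.maninConstant := by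
  intro h2
  have h2' : (2 : ℤ).natAbs ∣ D₀.maninConstant.natAbs := Int.natAbs_dvd_natAbs.mpr h2
  rw [natAbs_maninConstant₀_eq_one_of_stevensConstantOne_four_mul_prime_pow hq hq3 he hN D₁ D₀ hiso h₁ h₀ hSt1] at h2'
  norm_num at h2'

omit [W₁.IsElliptic] [W₁.IsGloballyMinimal] in
/-- **`N = 4q^e`, `q ≡ 3 (mod 4)`, F-need form: F-need ∧ Stevens I ⟹ `2 ∤ c₀` for EVERY lattice-optimal `X₀(N)`-datum** — C2 at these
levels with NO Stevens II and NO cell law.  CONDITIONAL; C2 OPEN; BSD not proved. [cite: Stevens1989, Conjecture I] -/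
theorem not_two_dvd_maninConstant₀_of_stevensConstantOne_four_mul_prime_pow_of_exists {N q e : ℕ} [NeZero N]
    (hq : q.Prime) (hq3 : q % 4 = 3) (he : e ≠ 0) (hN : N = 4 * q ^ e) (hex : exists_optimal_gamma1ParametrizationData)
    (hSt1 : StevensConstantOne) (D₀ : ModularParametrizationData W₀ N)
    (h₀ : ∀ z ∈ D₀.L.lattice, ∃ w ∈ periodLattice D₀.f, z = D₀.c * w) : ¬ (2 : ℤ) ∣ D₀.maninConstant := by
  obtain ⟨W₁, _, _, D₁, hiso, h₁⟩ := hex W₀ D₀ h₀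
  exact not_two_dvd_maninConstant₀_of_stevensConstantOne_four_mul_prime_pow hq hq3 he hN D₁ D₀ hiso h₁ h₀ hSt1

/-! ## §2 The index-`4`-free Stevens road at `N = u²v` with units of `ℤ/uv` of the form `± u₀^k` -/

/-- **Stevens II ⟹ `|c₀| = |c₁|` wherever index `4` is excluded by the level** (`N = u²v`, `4 ∣ N`, units of `ℤ/uv` are `± u₀^k`):
the tree's `natAbs_maninConstant₀_eq_of_maxCovolume_of_index_ne_four` with its index hypothesis DISCHARGED by
`not_periodLatticeGamma1_eq_two_mul_of_generator_mod`.  CONDITIONAL on Stevens II (`hmax`). [cite: Stevens1989, Conjecture II, Thm. 2.3] -/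
theorem natAbs_maninConstant₀_eq_of_maxCovolume_of_generator_mod {N : ℕ} [NeZero N] {u v m : ℕ} (hu : u ≠ 0)
    (hN : (N : ℤ) = (u : ℤ) ^ 2 * v) (hm : u * v = m) {u₀ : ZMod m} (hu₀ : IsUnit u₀)
    (hgen : ∀ w : (ZMod m)ˣ, ∃ k : ℕ, (w : ZMod m) = u₀ ^ k ∨ (w : ZMod m) = -(u₀ ^ k))
    (D₁ : Gamma1ParametrizationData W₁ N) (D₀ : ModularParametrizationData W₀ N) (hiso : IsIsogenous W₁ W₀)
    (h₁ : D₁.IsOptimal) (h₀ : ∀ z ∈ D₀.L.lattice, ∃ w ∈ periodLattice D₀.f, z = D₀.c * w) (h4 : 2 ^ 2 ∣ N)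
    (hmax : IsMaxCovolumeInClass W₁) : D₀.maninConstant.natAbs = D₁.maninConstant.natAbs :=
  natAbs_maninConstant₀_eq_of_maxCovolume_of_index_ne_four D₁ D₀ hiso h₁ h₀ h4 hmax
    (not_periodLatticeGamma1_eq_two_mul_of_generator_mod hu hN hm hu₀ hgen D₀ h₀ h4)

/-- **`N = 8p`, `p` odd prime: Stevens II ⟹ `|c₀| = |c₁|`.** CONDITIONAL on Stevens II. [cite: Stevens1989, Conjecture II] -/
theorem natAbs_maninConstant₀_eq_of_maxCovolume_eight_mul_prime {p : ℕ} (hp : p.Prime) (hp2 : p ≠ 2) [NeZero (8 * p)]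
    (D₁ : Gamma1ParametrizationData W₁ (8 * p)) (D₀ : ModularParametrizationData W₀ (8 * p))
    (hiso : IsIsogenous W₁ W₀) (h₁ : D₁.IsOptimal)
    (h₀ : ∀ z ∈ D₀.L.lattice, ∃ w ∈ periodLattice D₀.f, z = D₀.c * w) (hmax : IsMaxCovolumeInClass W₁) :
    D₀.maninConstant.natAbs = D₁.maninConstant.natAbs :=
  natAbs_maninConstant₀_eq_of_maxCovolume_of_index_ne_four D₁ D₀ hiso h₁ h₀ ⟨2 * p, by ring⟩ hmax
    (not_periodLatticeGamma1_eq_two_mul_eight_mul_prime hp hp2 D₀ h₀)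

/-- **`N = 16p`, `p` odd prime: Stevens II ⟹ `|c₀| = |c₁|`.** CONDITIONAL on Stevens II. [cite: Stevens1989, Conjecture II] -/
theorem natAbs_maninConstant₀_eq_of_maxCovolume_sixteen_mul_prime {p : ℕ} (hp : p.Prime) (hp2 : p ≠ 2) [NeZero (16 * p)]
    (D₁ : Gamma1ParametrizationData W₁ (16 * p)) (D₀ : ModularParametrizationData W₀ (16 * p))
    (hiso : IsIsogenous W₁ W₀) (h₁ : D₁.IsOptimal)
    (h₀ : ∀ z ∈ D₀.L.lattice, ∃ w ∈ periodLattice D₀.f, z = D₀.c * w) (hmax : IsMaxCovolumeInClass W₁) :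
    D₀.maninConstant.natAbs = D₁.maninConstant.natAbs :=
  natAbs_maninConstant₀_eq_of_maxCovolume_of_index_ne_four D₁ D₀ hiso h₁ h₀ ⟨4 * p, by ring⟩ hmax
    (not_periodLatticeGamma1_eq_two_mul_sixteen_mul_prime hp hp2 D₀ h₀)

/-- **`N ∈ {32, 64, 128, 256}`: Stevens II ⟹ `|c₀| = |c₁|`** (the CM / twist-minimal core classes `32a, 64a, 128a–d, 256a–d` of C2's line).
CONDITIONAL on Stevens II. [cite: Stevens1989, Conjecture II] -/
theorem natAbs_maninConstant₀_eq_of_maxCovolume_two_power {N : ℕ} [NeZero N] (hN : N = 32 ∨ N = 64 ∨ N = 128 ∨ N = 256)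
    (D₁ : Gamma1ParametrizationData W₁ N) (D₀ : ModularParametrizationData W₀ N) (hiso : IsIsogenous W₁ W₀)
    (h₁ : D₁.IsOptimal) (h₀ : ∀ z ∈ D₀.L.lattice, ∃ w ∈ periodLattice D₀.f, z = D₀.c * w)
    (hmax : IsMaxCovolumeInClass W₁) : D₀.maninConstant.natAbs = D₁.maninConstant.natAbs := by
  have h4 : 2 ^ 2 ∣ N := by rcases hN with rfl | rfl | rfl | rfl <;> norm_num
  exact natAbs_maninConstant₀_eq_of_maxCovolume_of_index_ne_four D₁ D₀ hiso h₁ h₀ h4 hmax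
    (not_periodLatticeGamma1_eq_two_mul_of_two_power hN D₀ h₀)

/-- **`N = 8p` or `16p` (`p` odd prime) or `N ∈ {32, 64, 128, 256}`: Stevens I ∧ Stevens II ⟹ `|c₀| = 1`.** CONDITIONAL (both OPEN).
[cite: Stevens1989, Conjectures I–II] -/
theorem natAbs_maninConstant₀_eq_one_of_stevensConjectures_reducedLevels {N : ℕ} [NeZero N]
    (hN : (∃ p : ℕ, p.Prime ∧ p ≠ 2 ∧ (N = 8 * p ∨ N = 16 * p)) ∨ (N = 32 ∨ N = 64 ∨ N = 128 ∨ N = 256))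
    (D₁ : Gamma1ParametrizationData W₁ N) (D₀ : ModularParametrizationData W₀ N) (hiso : IsIsogenous W₁ W₀)
    (h₁ : D₁.IsOptimal) (h₀ : ∀ z ∈ D₀.L.lattice, ∃ w ∈ periodLattice D₀.f, z = D₀.c * w) (hSt1 : StevensConstantOne)
    (hmax : IsMaxCovolumeInClass W₁) : D₀.maninConstant.natAbs = 1 := by
  rw [← natAbs_maninConstant_eq_one_of_stevensConstantOne hSt1 D₁ h₁]
  rcases hN with ⟨p, hp, hp2, rfl | rfl⟩ | h2
  · exact natAbs_maninConstant₀_eq_of_maxCovolume_eight_mul_prime hp hp2 D₁ D₀ hiso h₁ h₀ hmax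
  · exact natAbs_maninConstant₀_eq_of_maxCovolume_sixteen_mul_prime hp hp2 D₁ D₀ hiso h₁ h₀ hmax
  · exact natAbs_maninConstant₀_eq_of_maxCovolume_two_power h2 D₁ D₀ hiso h₁ h₀ hmax

/-- **C2 at `N = 8p, 16p, 32, 64, 128, 256` from Stevens I ∧ II: `2 ∤ c₀`.** CONDITIONAL; C2 OPEN. [cite: Stevens1989, Conjectures I–II] -/
theorem not_two_dvd_maninConstant₀_of_stevensConjectures_reducedLevels {N : ℕ} [NeZero N]
    (hN : (∃ p : ℕ, p.Prime ∧ p ≠ 2 ∧ (N = 8 * p ∨ N = 16 * p)) ∨ (N = 32 ∨ N = 64 ∨ N = 128 ∨ N = 256))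
    (D₁ : Gamma1ParametrizationData W₁ N) (D₀ : ModularParametrizationData W₀ N) (hiso : IsIsogenous W₁ W₀)
    (h₁ : D₁.IsOptimal) (h₀ : ∀ z ∈ D₀.L.lattice, ∃ w ∈ periodLattice D₀.f, z = D₀.c * w) (hSt1 : StevensConstantOne)
    (hmax : IsMaxCovolumeInClass W₁) : ¬ (2 : ℤ) ∣ D₀.maninConstant := by
  intro h2
  have h2' : (2 : ℤ).natAbs ∣ D₀.maninConstant.natAbs := Int.natAbs_dvd_natAbs.mpr h2
  rw [natAbs_maninConstant₀_eq_one_of_stevensConjectures_reducedLevels hN D₁ D₀ hiso h₁ h₀ hSt1 hmax] at h2'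
  norm_num at h2'

omit [W₁.IsElliptic] [W₁.IsGloballyMinimal] in
/-- **F-need form at `N = 8p, 16p, 32, 64, 128, 256`: F-need ∧ Stevens I ∧ Stevens II (for Stevens data of level `N`) ⟹ `2 ∤ c₀` for EVERY
lattice-optimal `X₀(N)`-datum** — C2 at these levels from Stevens' conjectures alone (E-an-152b discharged).  CONDITIONAL; C2 OPEN;
BSD not proved. [cite: Stevens1989, Conjectures I–II] -/
theorem not_two_dvd_maninConstant₀_of_stevensConjectures_reducedLevels_of_exists {N : ℕ} [NeZero N]
    (hN : (∃ p : ℕ, p.Prime ∧ p ≠ 2 ∧ (N = 8 * p ∨ N = 16 * p)) ∨ (N = 32 ∨ N = 64 ∨ N = 128 ∨ N = 256))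
    (hex : exists_optimal_gamma1ParametrizationData) (hSt1 : StevensConstantOne)
    (hSt2 : ∀ (W₁ : WeierstrassCurve ℚ) [W₁.IsElliptic] [W₁.IsGloballyMinimal]
      (D₁ : Gamma1ParametrizationData W₁ N), D₁.IsOptimal → IsMaxCovolumeInClass W₁)
    (D₀ : ModularParametrizationData W₀ N)
    (h₀ : ∀ z ∈ D₀.L.lattice, ∃ w ∈ periodLattice D₀.f, z = D₀.c * w) : ¬ (2 : ℤ) ∣ D₀.maninConstant := by
  obtain ⟨W₁, _, _, D₁, hiso, h₁⟩ := hex W₀ D₀ h₀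
  exact not_two_dvd_maninConstant₀_of_stevensConjectures_reducedLevels hN D₁ D₀ hiso h₁ h₀ hSt1 (hSt2 W₁ D₁ h₁)

end Summit.BirchSwinnertonDyer.BirchSwinnertonDyer.Theorems.ManinLocalTwoThree

end
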